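import Mathlib.RingTheory.MvPolynomial.Homogeneous
import Mathlib.Data.Matrix.Mul
import Literature.AlgebraicGeometry.Resolution.RegularSystemOfParameters
import Literature.AlgebraicGeometry.Hironaka2017.S04CharAlgebra.R004bEdgeGenerators
import HarnessLib

/-!
# [OURS · L1 W3.1] Edge-cone coordinates: two regular systems of parameters give the SAME edge ideal up to a
# degree-preserving `K`-algebra automorphism of `K[Z_1, …, Z_n]` (kernel helper for `CampaignW31InvWellDefinedI`)

Cell `res-hironaka` (run/shared/lean/pub/res-hironaka/), rung L slot W3.1; host crux
`Theses.MarkedTransfer.HypersurfaceOrderReduction` (stmt-ResolutionOfSingularities-16155, `--supports`, no new route).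
Offer res-type-005 2026-08-26T20:35:57Z (c) «coordinate independence», accepted by res-L1-k31 20:58:15Z.

HONEST FRAMING. Everything below is OURS-side commutative algebra about the tree's carriers (row 004's rendering
devices `S04CharAlgebra.polyMap`, `zbar`, `edgeG`, `IsRSP` over the tree's `Resolution.FibreCone`); NOTHING here is a
statement of H. Hironaka's manuscript *Resolution of singularities in positive characteristics* (2017) and no
candidate statement of it is used as a premise. AI-produced kernel evidence, weaker than expert review.

## What is proved

For a local ring `O` with residue field `K` and two systems `z, z' : Fin n → O` each generating `max(O)` MINIMALLY
(`S04CharAlgebra.IsRSP`: `(z) = max(O)`, `n = spanFinrank max(O)`, `O` regular):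

* linear substitutions `Z_i ↦ Σ_k c_{ik} Z_k` of `K[Z_1, …, Z_n]` (Mathlib `MvPolynomial.aeval`, no new definition):
  composition = matrix product (`CampaignW31.linSubst_comp`), identity (`linSubst_one`), degree preservation
  (`isHomogeneous_linSubst`); mutually inverse matrices give an automorphism (`AlgEquiv.ofAlgHom`).
* `CampaignW31.entry_mem_maximalIdeal_of_sum_mul_eq_zero` — MINIMALITY: if `Σ_j N_{ij} z_j = 0` for all `i` then every
  `N_{ij} ∈ max(O)` (a unit entry would make one `z_j` redundant; tree `Resolution.not_mem_span_image_of_not_mem`,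
  Matsumura Thm. 14.2).
* `CampaignW31.zbar_eq_sum` — writing `z_i = Σ_k c_{ik} z'_k`, the classes satisfy `z̄_i = Σ_k c̄_{ik} z̄'_k` in the
  fibre cone `bl_ξ(Z)/max(O_ξ) bl_ξ(Z)`.
* **`CampaignW31.exists_algEquiv_polyMap_comp`** — there is a `K`-algebra automorphism `θ` of `K[Z]`, preserving
  homogeneity and degree in both directions, with `polyMap z' ∘ θ = polyMap z`; consequently the pull-backs
  `edgeG P z` / `edgeG P z'` of ANY subset of the fibre cone correspond under `θ` (`mem_edgeG_iff_of_polyMap_comp`).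
  The transition matrices `c̄`, `c̄'` are mutually inverse because `(c c' − 1) z = 0` forces `c c' ≡ 1 (mod max(O))`.

## References (context only)

* H. Matsumura, *Commutative Ring Theory*, CUP 1986, Thm. 14.2 (minimal bases of `𝔪`). [Matsumura1987]
* V. Cossart, U. Jannsen, S. Saito, LNM 2270 (2020), Rem. 2.9 (b) (`ν*` is an invariant of the graded algebra —
  the use made of `θ` downstream). [CossartJannsenSaito2020]
-/

noncomputable section

set_option linter.dupNamespace false -- mandated namespace of this single-conjunct summit

open IsLocalRing MvPolynomial

namespace Summit.ResolutionOfSingularities.ResolutionOfSingularities.Theorems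

open Literature.AlgebraicGeometry.Resolution
open Literature.AlgebraicGeometry.Hironaka2017.S04CharAlgebra

universe u

namespace CampaignW31

/-! ## Linear substitutions of `K[Z_1, …, Z_n]` -/

section LinSubst

variable {κ : Type*} [Field κ] {n : ℕ}

/-- [folklore] Composition of the linear substitutions `Z_i ↦ Σ_k c_{ik} Z_k` (the `κ`-algebra endomorphism
`MvPolynomial.aeval (fun i => Σ_k C (c i k) * X k)` of `κ[Z_1, …, Z_n]` attached to a square matrix `c`) is the
substitution of the matrix product: `subst(c') ∘ subst(c) = subst(c c')`. -/
theorem linSubst_comp (c c' : Matrix (Fin n) (Fin n) κ) :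
    (MvPolynomial.aeval (R := κ) fun i : Fin n => ∑ k, C (c' i k) * X k).comp
        (MvPolynomial.aeval fun i : Fin n => ∑ k, C (c i k) * X k) =
      MvPolynomial.aeval fun i : Fin n => ∑ k, C ((c * c') i k) * X k := by
  refine MvPolynomial.algHom_ext fun i => ?_
  rw [AlgHom.comp_apply, aeval_X, aeval_X, map_sum]
  simp_rw [map_mul, algHom_C, aeval_X, Finset.mul_sum, Matrix.mul_apply, map_sum, Finset.sum_mul]
  rw [Finset.sum_comm]
  refine Finset.sum_congr rfl fun j _ => Finset.sum_congr rfl fun k _ => ?_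
  rw [MvPolynomial.algebraMap_eq, map_mul, mul_assoc]

/-- [folklore] The identity matrix gives the identity substitution. -/
theorem linSubst_one :
    (MvPolynomial.aeval fun i : Fin n => ∑ k, C ((1 : Matrix (Fin n) (Fin n) κ) i k) * X k) =
      AlgHom.id κ (MvPolynomial (Fin n) κ) := by
  refine MvPolynomial.algHom_ext fun i => ?_
  rw [aeval_X, AlgHom.id_apply, Finset.sum_eq_single i]
  · rw [Matrix.one_apply_eq, C_1, one_mul]
  · intro k _ hk
    rw [Matrix.one_apply_ne (Ne.symm hk), C_0, zero_mul]
  · intro h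
    exact absurd (Finset.mem_univ i) h

/-- [folklore] A linear substitution preserves homogeneity and degree. -/
theorem isHomogeneous_linSubst (c : Matrix (Fin n) (Fin n) κ) {φ : MvPolynomial (Fin n) κ} {d : ℕ}
    (hφ : φ.IsHomogeneous d) :
    (MvPolynomial.aeval (fun i : Fin n => ∑ k, C (c i k) * X k) φ).IsHomogeneous d := by
  have h := hφ.aeval (fun i => ∑ k, C (c i k) * X k) (n := 1) fun i =>
    IsHomogeneous.sum _ _ _ fun k _ => (isHomogeneous_X κ k).C_mul (c i k)
  rw [one_mul] at h
  exact h

end LinSubst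

/-! ## Minimal generating systems of `max(O)` -/

section Local

variable {O : Type u} [CommRing O] [IsLocalRing O] {n : ℕ}

/-- [folklore] MINIMALITY of a regular system of parameters (row 004's `IsRSP`: `(z) = max(O)` with
`n = spanFinrank max(O)` members): a relation matrix `N` with `Σ_j N_{ij} z_j = 0` for every `i` has all its entries
in `max(O)` — a unit entry `N_{ij}` would put `z_j` in the ideal of the other members, contradicting minimality
(tree `Resolution.not_mem_span_image_of_not_mem`, Matsumura Thm. 14.2). -/
theorem entry_mem_maximalIdeal_of_sum_mul_eq_zero {z : Fin n → O} (hz : IsRSP O z)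
    (N : Matrix (Fin n) (Fin n) O) (hN : ∀ i, ∑ j, N i j * z j = 0) (i j : Fin n) :
    N i j ∈ maximalIdeal O := by
  classical
  by_contra hunit
  have hu : IsUnit (N i j) := by
    by_contra h
    exact hunit ((IsLocalRing.mem_maximalIdeal _).mpr h)
  haveI := hz.1
  refine Literature.AlgebraicGeometry.Resolution.not_mem_span_image_of_not_mem hz.2.2 z hz.2.1
    (S := {j' | j' ≠ j}) (i := j) (fun h => h rfl) ?_
  obtain ⟨u, hu⟩ := hu
  have hsplit : N i j * z j + ∑ j' ∈ Finset.univ.erase j, N i j' * z j' = 0 := by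
    rw [Finset.add_sum_erase _ (fun j' => N i j' * z j') (Finset.mem_univ j)]
    exact hN i
  have hzj : z j = -(↑u⁻¹ * ∑ j' ∈ Finset.univ.erase j, N i j' * z j') := by
    have h1 : N i j * z j = -∑ j' ∈ Finset.univ.erase j, N i j' * z j' :=
      eq_neg_of_add_eq_zero_left hsplit
    calc z j = ↑u⁻¹ * (N i j * z j) := by rw [← hu, ← mul_assoc, Units.inv_mul, one_mul]
      _ = _ := by rw [h1, mul_neg]
  rw [hzj]
  refine Submodule.neg_mem _ (Ideal.mul_mem_left _ _ (Ideal.sum_mem _ fun j' hj' =>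
    Ideal.mul_mem_left _ _ (Ideal.subset_span ⟨j', (Finset.mem_erase.mp hj').1, rfl⟩)))

/-- [folklore] Transition coefficients pass to the fibre cone: if `z_i = Σ_k c_{ik} z'_k` in `max(O)` then
`z̄_i = Σ_k c̄_{ik} z̄'_k` in `bl(O)/max(O) bl(O)` (row 004's `zbar`, `nu`; `c̄` = residue classes mapped in by the tree's
`fibreConeResidueMap`). -/
theorem zbar_eq_sum {z z' : Fin n → O} (hz : Ideal.span (Set.range z) = maximalIdeal O)
    (hz' : Ideal.span (Set.range z') = maximalIdeal O) (c : Matrix (Fin n) (Fin n) O)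
    (hc : ∀ i, ∑ k, c i k * z' k = z i) (i : Fin n) :
    zbar z hz i = ∑ k, fibreConeResidueMap (maximalIdeal O) (residue O (c i k)) * zbar z' hz' k := by
  have hmem' : ∀ k, z' k ∈ maximalIdeal O ^ 1 := fun k =>
    (pow_one (maximalIdeal O)).ge (hz' ▸ Ideal.subset_span ⟨k, rfl⟩)
  have hmem : z i ∈ maximalIdeal O ^ 1 := (pow_one (maximalIdeal O)).ge (hz ▸ Ideal.subset_span ⟨i, rfl⟩)
  have key : ReesRing.tMonomial (maximalIdeal O) 1 (z i) hmem =
      ∑ k, algebraMap O (ReesRing (maximalIdeal O)) (c i k) * ReesRing.tMonomial (maximalIdeal O) 1 (z' k) (hmem' k) := by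
    apply ReesRing.ext (maximalIdeal O)
    rw [ReesRing.poly_tMonomial, ← ReesRing.polyAddHom_apply, map_sum]
    simp only [ReesRing.polyAddHom_apply, ReesRing.poly_mul, ReesRing.poly_algebraMap, ReesRing.poly_tMonomial,
      Polynomial.C_mul_monomial]
    rw [← map_sum (Polynomial.monomial 1), hc i]
  unfold zbar blMonomial
  rw [key, map_sum]
  refine Finset.sum_congr rfl fun k _ => ?_
  rw [map_mul]
  rfl

/-- **[OURS · L1 W3.1] coordinate change for the edge cone.** For two regular systems of parameters `z`, `z'` of the
local ring `O` (row 004's `IsRSP`), there is a `K`-algebra automorphism `θ` of `K[Z_1, …, Z_n]` (`K` = residue field)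
preserving homogeneity and degree in both directions and intertwining row 004's evaluation maps:
`polyMap z' (θ f) = polyMap z f` for all `f`. (`θ` is the linear substitution by the residue matrix `c̄` of
`z_i = Σ_k c_{ik} z'_k`; its inverse is `c̄'` from `z'_k = Σ_j c'_{kj} z_j`, because `(c c' − 1) z = 0` forces
`c c' ≡ 1 mod max(O)` by minimality.) Replaces nothing printed; NOT a statement of the manuscript. [folklore] -/
theorem exists_algEquiv_polyMap_comp {z z' : Fin n → O} (hz : IsRSP O z) (hz' : IsRSP O z') :
    ∃ θ : MvPolynomial (Fin n) (ResidueField O) ≃ₐ[ResidueField O] MvPolynomial (Fin n) (ResidueField O),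
      (∀ (d : ℕ) (f : MvPolynomial (Fin n) (ResidueField O)), f.IsHomogeneous d → (θ f).IsHomogeneous d) ∧
      (∀ (d : ℕ) (f : MvPolynomial (Fin n) (ResidueField O)), f.IsHomogeneous d → (θ.symm f).IsHomogeneous d) ∧
      ∀ f, polyMap z' hz'.2.1 (θ f) = polyMap z hz.2.1 f := by
  classical
  have hmem : ∀ i, z i ∈ Ideal.span (Set.range z') := fun i => by
    rw [hz'.2.1, ← hz.2.1]; exact Ideal.subset_span ⟨i, rfl⟩
  have hmem' : ∀ k, z' k ∈ Ideal.span (Set.range z) := fun k => by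
    rw [hz.2.1, ← hz'.2.1]; exact Ideal.subset_span ⟨k, rfl⟩
  choose c hc using fun i => Ideal.mem_span_range_iff_exists_fun.mp (hmem i)
  choose c' hc' using fun k => Ideal.mem_span_range_iff_exists_fun.mp (hmem' k)
  -- `(c c') z = z` and `(c' c) z' = z'`
  have hcc' : ∀ i, ∑ j, ((∑ k, c i k * c' k j) - if i = j then 1 else 0) * z j = 0 := by
    intro i
    simp only [sub_mul, Finset.sum_sub_distrib, ite_mul, one_mul, zero_mul, Finset.sum_ite_eq, Finset.mem_univ,
      if_true]
    have : ∑ j, (∑ k, c i k * c' k j) * z j = z i := by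
      calc ∑ j, (∑ k, c i k * c' k j) * z j = ∑ k, c i k * ∑ j, c' k j * z j := by
            simp_rw [Finset.sum_mul, Finset.mul_sum, mul_assoc]
            rw [Finset.sum_comm]
        _ = ∑ k, c i k * z' k := Finset.sum_congr rfl fun k _ => by rw [hc' k]
        _ = z i := hc i
    rw [this, sub_self]
  have hc'c : ∀ k, ∑ j, ((∑ i, c' k i * c i j) - if k = j then 1 else 0) * z' j = 0 := by
    intro k
    simp only [sub_mul, Finset.sum_sub_distrib, ite_mul, one_mul, zero_mul, Finset.sum_ite_eq, Finset.mem_univ,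
      if_true]
    have : ∑ j, (∑ i, c' k i * c i j) * z' j = z' k := by
      calc ∑ j, (∑ i, c' k i * c i j) * z' j = ∑ i, c' k i * ∑ j, c i j * z' j := by
            simp_rw [Finset.sum_mul, Finset.mul_sum, mul_assoc]
            rw [Finset.sum_comm]
        _ = ∑ i, c' k i * z i := Finset.sum_congr rfl fun i _ => by rw [hc i]
        _ = z' k := hc' k
    rw [this, sub_self]
  -- residue matrices are mutually inverse
  set cb : Matrix (Fin n) (Fin n) (ResidueField O) := fun i k => residue O (c i k) with hcb
  set cb' : Matrix (Fin n) (Fin n) (ResidueField O) := fun k j => residue O (c' k j) with hcb'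
  have h1 : cb * cb' = 1 := by
    ext i j
    have key := entry_mem_maximalIdeal_of_sum_mul_eq_zero hz
      (fun i j => (∑ k, c i k * c' k j) - if i = j then 1 else 0) hcc' i j
    rw [← residue_eq_zero_iff, map_sub, sub_eq_zero, map_sum] at key
    rw [Matrix.mul_apply, Matrix.one_apply]
    simp only [hcb, hcb']
    simp_rw [← map_mul]
    rw [key]
    split_ifs <;> simp
  have h2 : cb' * cb = 1 := by
    ext k j
    have key := entry_mem_maximalIdeal_of_sum_mul_eq_zero hz'
      (fun k j => (∑ i, c' k i * c i j) - if k = j then 1 else 0) hc'c k j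
    rw [← residue_eq_zero_iff, map_sub, sub_eq_zero, map_sum] at key
    rw [Matrix.mul_apply, Matrix.one_apply]
    simp only [hcb, hcb']
    simp_rw [← map_mul]
    rw [key]
    split_ifs <;> simp
  -- `θ = subst(c̄)` with inverse `subst(c̄')`
  refine ⟨AlgEquiv.ofAlgHom (MvPolynomial.aeval fun i : Fin n => ∑ k, C (cb i k) * X k)
      (MvPolynomial.aeval fun i : Fin n => ∑ k, C (cb' i k) * X k)
      (by rw [linSubst_comp, h2, linSubst_one]) (by rw [linSubst_comp, h1, linSubst_one]),
    fun d f hf => isHomogeneous_linSubst cb hf, fun d f hf => isHomogeneous_linSubst cb' hf, ?_⟩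
  -- the intertwining property, checked on `C a` and `X i`
  have hcomp : (polyMap z' hz'.2.1).comp
      (MvPolynomial.aeval fun i : Fin n => ∑ k, C (cb i k) * X k).toRingHom = polyMap z hz.2.1 := by
    refine MvPolynomial.ringHom_ext (fun a => ?_) (fun i => ?_)
    · rw [RingHom.comp_apply, AlgHom.toRingHom_eq_coe, AlgHom.coe_toRingHom, algHom_C, MvPolynomial.algebraMap_eq]
      unfold polyMap
      rw [eval₂Hom_C, eval₂Hom_C]
    · rw [RingHom.comp_apply, AlgHom.toRingHom_eq_coe, AlgHom.coe_toRingHom, aeval_X, map_sum]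
      unfold polyMap
      rw [eval₂Hom_X', zbar_eq_sum hz.2.1 hz'.2.1 c hc i]
      refine Finset.sum_congr rfl fun k _ => ?_
      rw [map_mul, eval₂Hom_C, eval₂Hom_X']
  intro f
  exact RingHom.congr_fun hcomp f

/-- [folklore] Consequence: the pull-backs of ANY subset `S` of the fibre cone along `polyMap z` and `polyMap z'`
correspond under an intertwining `θ` — in particular row 004's `edgeG P z = polyMap z ⁻¹(℘̄(E)(ξ))` and `edgeG P z'`:
`f ∈ edgeG P z ↔ θ f ∈ edgeG P z'`. -/
theorem mem_edgeG_iff_of_polyMap_comp {z z' : Fin n → O} (hz : Ideal.span (Set.range z) = maximalIdeal O)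
    (hz' : Ideal.span (Set.range z') = maximalIdeal O)
    {θ : MvPolynomial (Fin n) (ResidueField O) ≃ₐ[ResidueField O] MvPolynomial (Fin n) (ResidueField O)}
    (hθ : ∀ f, polyMap z' hz' (θ f) = polyMap z hz f) (P : Subalgebra O (Polynomial O))
    (f : MvPolynomial (Fin n) (ResidueField O)) :
    f ∈ edgeG P z hz ↔ θ f ∈ edgeG P z' hz' := by
  simp only [edgeG, Set.mem_preimage, hθ f]

end Local

end CampaignW31

end Summit.ResolutionOfSingularities.ResolutionOfSingularities.Theorems

end
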